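import Literature.Combinatorics.HironakaPolyhedraGame.MonomialMarkedGameResolution
import Literature.Combinatorics.HironakaPolyhedraGame.MonomialEResolutionFan

/-!
# `Blanco2012a_thm_4_6_monomial` holds: E-resolution of monomial basic objects on fan stages (F-70 discharged)

Sources: [Blanco2012a] Thm. 4.6 (monomial case), Def. 1.16/1.18/1.22/1.24, Rem. 1.23; [EncinasVillamayor1998] Def. 1.4;
[Fulton1993Toric] §2.6.

This file TRANSPORTS the abstract resolution theorem `MGame.solvable_of_wf` (`MonomialMarkedGameResolution.lean`: every
well-formed state of the marked monomial game is solvable, all dimensions) to the fan-stage rendering of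
`MonomialEResolution.lean` and proves the named fact

* `Blanco2012a_thm_4_6_monomial_holds : Blanco2012a_thm_4_6_monomial`.

Dictionary (a strictly reachable stage `S` is a fan with coherent heights `H`, `MonomialEResolutionFan.lean`): a ray NAME is
an injective code of the LIFTED ray `(r, b(r)) ∈ ℤⁿ × ℤ`; the abstract cone of a corner is the set of names of its lifted
rays; the abstract exponent of the name of `(r, b)` at the generator `v ∈ A` is `⟨v, r⟩ − b` (`coordN`); a legal abstract
face is a `LegalFaceN` (legality is face-intrinsic on fans), the single face `[R]` is a legal print-move family and
`S.blowupFamily [R] = S.blowup R`; the abstract move with the fresh name of `(ρ_R, 1 + Σ_R b)` is the blown-up stage (for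
`|R| ≥ 2` the vector `ρ_R` is fresh by the fan property, for `|R| = 1` the height is new); an abstract done cone is a
strictly won corner.  Everything proved; no new named fact (net debt −1); no instance, no notation.
-/

namespace Literature.Combinatorics.HironakaPolyhedraGame

open Finset
open scoped BigOperators
open Classical

variable {n : ℕ}

namespace MonomialTransport

/-- The lifted ray `(r_k, b_k)` of slot `k`. [cite: Blanco2012a, Def. 1.16] -/
def lift (c : HConeN n) (k : Fin n) : (Fin n → ℤ) × ℤ := (c.ray k, c.height k)

variable (enc : (Fin n → ℤ) × ℤ → ℕ)

/-- The NAME SET of a corner: the codes of its lifted rays. [cite: Blanco2012a, Def. 1.16, Rem. 1.23] -/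
def names (c : HConeN n) : Finset ℕ := Finset.univ.image (fun k => enc (lift c k))

/-- The abstract cones of a stage. [cite: Blanco2012a, Def. 1.16] -/
def absCones (S : HStageN n) : Finset (Finset ℕ) := (S.map (names enc)).toFinset

/-- The decoded lifted ray of a name (a left inverse of `enc` on its range). [cite: Blanco2012a, Def. 1.16] -/
noncomputable def dec (x : ℕ) : (Fin n → ℤ) × ℤ := Function.invFun enc x

/-- The abstract exponent table: the name of `(r, b)` has exponent `⟨v, r⟩ − b` at the generator `v ∈ A` (the chart formula
`coordN`).  [cite: Blanco2012a, Def. 1.22; EncinasVillamayor1998, Def. 1.4] -/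
noncomputable def E (A : Finset (Fin n → ℚ)) (x : ℕ) (v : ↥A) : ℚ :=
  (∑ i, v.1 i * ((dec enc x).1 i : ℚ)) - ((dec enc x).2 : ℚ)

/-- The abstract state attached to a stage with the given used-name set. [cite: Blanco2012a, Def. 1.16] -/
noncomputable def absState (A : Finset (Fin n → ℚ)) (S : HStageN n) (U : Finset ℕ) : MGame ↥A :=
  { cones := absCones enc S, expo := E enc A, used := U }

variable {enc}

/-- Decoding a code. [folklore] -/
private theorem dec_enc (henc : Function.Injective enc) (p : (Fin n → ℤ) × ℤ) : dec enc (enc p) = p :=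
  Function.leftInverse_invFun henc p

/-- The abstract exponent of the name of `(r, b)` is `⟨v, r⟩ − b`. [cite: EncinasVillamayor1998, Def. 1.4] -/
theorem E_enc (henc : Function.Injective enc) (A : Finset (Fin n → ℚ)) (r : Fin n → ℤ) (b : ℤ) (v : ↥A) :
    E enc A (enc (r, b)) v = (∑ i, v.1 i * (r i : ℚ)) - (b : ℚ) := by
  unfold E; rw [dec_enc henc]

/-- In an independent corner the lifted rays, hence their names, are pairwise distinct. [cite: Fulton1993Toric, §2.6] -/
theorem names_injective (henc : Function.Injective enc) {c : HConeN n} (hc : c.Indep) :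
    Function.Injective (fun k => enc (lift c k)) := by
  intro k k' h
  have h1 : lift c k = lift c k' := henc h
  exact hc.ray_injective (congrArg Prod.fst h1)

/-- Membership in the name set. [cite: Blanco2012a, Rem. 1.23] -/
theorem mem_names {c : HConeN n} {x : ℕ} : x ∈ names enc c ↔ ∃ k, enc (lift c k) = x := by
  simp [names]

/-- The name set of an independent corner has `n` elements. [cite: Blanco2012a, Def. 1.16] -/
theorem card_names (henc : Function.Injective enc) {c : HConeN n} (hc : c.Indep) : (names enc c).card = n := by
  unfold names
  rw [Finset.card_image_of_injective _ (names_injective henc hc), Finset.card_univ, Fintype.card_fin]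

/-- Membership in the abstract cones. [cite: Blanco2012a, Def. 1.16] -/
theorem mem_absCones {S : HStageN n} {C : Finset ℕ} : C ∈ absCones enc S ↔ ∃ c ∈ S, names enc c = C := by
  simp [absCones]

/-- Sums over the name set of an independent corner are sums over its slots. [cite: Blanco2012a, Rem. 1.23] -/
theorem sum_names (henc : Function.Injective enc) {c : HConeN n} (hc : c.Indep) (f : ℕ → ℚ) :
    ∑ x ∈ names enc c, f x = ∑ k, f (enc (lift c k)) := by
  unfold names
  rw [Finset.sum_image (fun k _ k' _ h => names_injective henc hc h)]

/-- The abstract face sum over the names of a set of slots is the board sum over those slots.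
[cite: Blanco2012a, Def. 1.18, Rem. 1.13] -/
theorem sum_image_slots (henc : Function.Injective enc) (A : Finset (Fin n → ℚ)) {c : HConeN n} (hc : c.Indep)
    (T : Finset (Fin n)) (v : ↥A) :
    ∑ x ∈ T.image (fun k => enc (lift c k)), E enc A x v = ∑ t ∈ T, coordN v.1 c.ray c.height t := by
  rw [Finset.sum_image (fun k _ k' _ h => names_injective henc hc h)]
  refine Finset.sum_congr rfl (fun t _ => ?_)
  show E enc A (enc (c.ray t, c.height t)) v = _
  rw [E_enc henc]
  rfl

/-! ## §2 Faces: from an abstract face (names) to the face of ray vectors -/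

section Faces

variable (enc : (Fin n → ℤ) × ℤ → ℕ)

/-- The face of ray vectors of `c` named by the abstract face `Rabs`. [cite: Blanco2012a, Rem. 1.23] -/
def vecFace (c : HConeN n) (Rabs : Finset ℕ) : Finset (Fin n → ℤ) :=
  (Finset.univ.filter (fun t => enc (lift c t) ∈ Rabs)).image c.ray

variable {enc}

/-- The slots of the named face are the slots whose names lie in `Rabs`. [cite: Blanco2012a, Rem. 1.23] -/
theorem slots_vecFace {c : HConeN n} (hc : c.Indep) (Rabs : Finset ℕ) :
    c.slots (vecFace enc c Rabs) = Finset.univ.filter (fun t => enc (lift c t) ∈ Rabs) := by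
  ext t
  simp only [HConeN.mem_slots, vecFace, Finset.mem_image, Finset.mem_filter, Finset.mem_univ, true_and]
  constructor
  · rintro ⟨t', ht', htt'⟩
    have : t' = t := hc.ray_injective htt'
    subst this; exact ht'
  · intro ht; exact ⟨t, ht, rfl⟩

/-- `c` contains the named face. [cite: Blanco2012a, Rem. 1.23] -/
theorem contains_vecFace (c : HConeN n) (Rabs : Finset ℕ) : c.Contains (vecFace enc c Rabs) := by
  intro r hr
  obtain ⟨t, -, rfl⟩ := Finset.mem_image.mp hr
  exact Finset.mem_image.mpr ⟨t, Finset.mem_univ _, rfl⟩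

/-- The names of the slots of the named face are `Rabs` itself (when `Rabs` consists of names of `c`).
[cite: Blanco2012a, Rem. 1.23] -/
theorem image_slots_vecFace {c : HConeN n} (hc : c.Indep) {Rabs : Finset ℕ}
    (hsub : Rabs ⊆ names enc c) :
    (c.slots (vecFace enc c Rabs)).image (fun k => enc (lift c k)) = Rabs := by
  rw [slots_vecFace hc]
  ext x
  simp only [Finset.mem_image, Finset.mem_filter, Finset.mem_univ, true_and]
  constructor
  · rintro ⟨t, ht, rfl⟩; exact ht
  · intro hx
    obtain ⟨k, hk⟩ := (mem_names (enc := enc)).mp (hsub hx)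
    exact ⟨k, by rw [hk]; exact hx, hk⟩

/-- The named face is non-empty when `Rabs` is a non-empty set of names of `c`. [cite: Blanco2012a, Rem. 1.23] -/
theorem vecFace_nonempty {c : HConeN n} {Rabs : Finset ℕ} (hne : Rabs.Nonempty) (hsub : Rabs ⊆ names enc c) :
    (vecFace enc c Rabs).Nonempty := by
  obtain ⟨x, hx⟩ := hne
  obtain ⟨k, hk⟩ := (mem_names (enc := enc)).mp (hsub hx)
  refine ⟨c.ray k, Finset.mem_image.mpr ⟨k, ?_, rfl⟩⟩
  simp only [Finset.mem_filter, Finset.mem_univ, true_and]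
  rw [hk]; exact hx

/-- With coherent heights `H`, the abstract face is the set of names `enc (r, H r)`, `r` in the named face.
[cite: Blanco2012a, Def. 1.16, Rem. 1.23] -/
theorem eq_image_vecFace {c : HConeN n} {Rabs : Finset ℕ} (hsub : Rabs ⊆ names enc c)
    {H : (Fin n → ℤ) → ℤ} (hH : ∀ k, c.height k = H (c.ray k)) :
    Rabs = (vecFace enc c Rabs).image (fun r => enc (r, H r)) := by
  ext x
  simp only [vecFace, Finset.image_image, Finset.mem_image, Finset.mem_filter, Finset.mem_univ, true_and,
    Function.comp_apply]
  constructor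
  · intro hx
    obtain ⟨k, hk⟩ := (mem_names (enc := enc)).mp (hsub hx)
    refine ⟨k, by rw [hk]; exact hx, ?_⟩
    rw [← hk]; show enc (c.ray k, H (c.ray k)) = enc (c.ray k, c.height k); rw [hH k]
  · rintro ⟨t, ht, rfl⟩
    have : enc (c.ray t, H (c.ray t)) = enc (lift c t) := by
      show enc (c.ray t, H (c.ray t)) = enc (c.ray t, c.height t); rw [hH t]
    rw [this]; exact ht

/-- With coherent heights, a corner contains the named face iff its name set contains `Rabs`.
[cite: Blanco2012a, Def. 1.16, Rem. 1.23] -/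
theorem contains_iff_subset_names (henc : Function.Injective enc) {c c' : HConeN n} {Rabs : Finset ℕ}
    (hsub : Rabs ⊆ names enc c) {H : (Fin n → ℤ) → ℤ} (hH : ∀ k, c.height k = H (c.ray k))
    (hH' : ∀ k, c'.height k = H (c'.ray k)) :
    c'.Contains (vecFace enc c Rabs) ↔ Rabs ⊆ names enc c' := by
  constructor
  · intro hcont x hx
    rw [eq_image_vecFace hsub hH] at hx
    obtain ⟨r, hr, rfl⟩ := Finset.mem_image.mp hx
    obtain ⟨j, -, hj⟩ := Finset.mem_image.mp (hcont hr)
    refine (mem_names (enc := enc)).mpr ⟨j, ?_⟩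
    show enc (c'.ray j, c'.height j) = enc (r, H r)
    rw [hH' j, hj]
  · intro hRabs r hr
    have hx : enc (r, H r) ∈ Rabs := by
      rw [eq_image_vecFace hsub hH]; exact Finset.mem_image_of_mem _ hr
    obtain ⟨j, hj⟩ := (mem_names (enc := enc)).mp (hRabs hx)
    have : c'.ray j = r := by
      have h1 : (c'.ray j, c'.height j) = (r, H r) := henc hj
      exact congrArg Prod.fst h1
    exact Finset.mem_image.mpr ⟨j, Finset.mem_univ _, this⟩

/-- The name set of a child: the old slot's name is replaced by the name of the new lifted ray
`(ρ_R, 1 + Σ_{r∈R} H r)`.  [cite: Blanco2012a, Def. 1.22; EncinasVillamayor1998, Def. 1.4] -/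
theorem names_child (henc : Function.Injective enc) {c : HConeN n} (hc : c.Indep) {R : Finset (Fin n → ℤ)}
    (hR : c.Contains R) {H : (Fin n → ℤ) → ℤ} (hH : ∀ k, c.height k = H (c.ray k)) {j : Fin n} (hj : j ∈ c.slots R) :
    names enc (c.child (c.slots R) j) =
      insert (enc (rhoN R, 1 + ∑ r ∈ R, H r)) ((names enc c).erase (enc (lift c j))) := by
  have _ := hj
  ext x
  simp only [mem_names, Finset.mem_insert, Finset.mem_erase]
  constructor
  · rintro ⟨k, rfl⟩
    by_cases hk : k = j
    · subst hk
      left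
      show enc ((c.child (c.slots R) k).ray k, (c.child (c.slots R) k).height k) = _
      rw [HConeN.ray_child_slots_self hc hR, HConeN.height_child_slots_self hc hR k hH]
    · right
      refine ⟨fun h => hk (names_injective henc hc ?_), k, ?_⟩
      · show enc (lift c k) = enc (lift c j)
        rw [← h]; show enc (lift c k) = enc ((c.child (c.slots R) j).ray k, (c.child (c.slots R) j).height k)
        rw [HConeN.ray_child_of_ne c _ hk, HConeN.height_child_of_ne c _ hk]; rfl
      · show enc (lift c k) = enc ((c.child (c.slots R) j).ray k, (c.child (c.slots R) j).height k)
        rw [HConeN.ray_child_of_ne c _ hk, HConeN.height_child_of_ne c _ hk]; rfl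
  · rintro (rfl | ⟨hne, k, rfl⟩)
    · refine ⟨j, ?_⟩
      show enc ((c.child (c.slots R) j).ray j, (c.child (c.slots R) j).height j) = _
      rw [HConeN.ray_child_slots_self hc hR, HConeN.height_child_slots_self hc hR j hH]
    · have hk : k ≠ j := fun h => hne (by rw [h])
      refine ⟨k, ?_⟩
      show enc ((c.child (c.slots R) j).ray k, (c.child (c.slots R) j).height k) = enc (lift c k)
      rw [HConeN.ray_child_of_ne c _ hk, HConeN.height_child_of_ne c _ hk]; rfl

end Faces

/-! ## §3 Legality, print-moves, wins -/

section Legal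

variable {enc : (Fin n → ℤ) × ℤ → ℕ}

/-- An abstract legal face of the name set of a corner of a FAN stage is a legal face of the stage (legality is
face-intrinsic on fans).  [cite: Blanco2012a, Def. 1.18, Thm. 4.6 B)] -/
theorem legalFaceN_of_sums (henc : Function.Injective enc) {A : Finset (Fin n → ℚ)} {S : HStageN n} (hS : S.IsFan)
    {c : HConeN n} (hc : c ∈ S) {Rabs : Finset ℕ} (hne : Rabs.Nonempty) (hsub : Rabs ⊆ names enc c)
    (hsum : ∀ v : ↥A, (1 : ℚ) ≤ ∑ x ∈ Rabs, E enc A x v) : LegalFaceN A S (vecFace enc c Rabs) := by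
  have hcI : c.Indep := hS.1 c hc
  refine ⟨vecFace_nonempty hne hsub, ⟨c, hc, contains_vecFace c Rabs⟩, fun c' hc' hcont => ?_⟩
  rw [← hS.isPermissible_iff A hc hc' (contains_vecFace c Rabs) hcont]
  intro a ha
  obtain ⟨v, hv, rfl⟩ := Finset.mem_image.mp ha
  have := hsum ⟨v, hv⟩
  rw [← image_slots_vecFace hcI hsub, sum_image_slots henc A hcI] at this
  exact this

/-- Blowing up the one-member family `[R]` is blowing up `R`. [cite: Blanco2012a, Thm. 4.6 B)] -/
theorem blowupFamily_singleton (S : HStageN n) (R : Finset (Fin n → ℤ)) : S.blowupFamily [R] = S.blowup R := by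
  unfold HStageN.blowupFamily HStageN.blowup
  congr 1
  refine List.map_congr_left (fun c _ => ?_)
  unfold HConeN.blowupFamily
  by_cases h : c.Contains R
  · have : [R].find? (fun R' => decide (c.Contains R')) = some R := by simp [h]
    rw [this]
  · have : [R].find? (fun R' => decide (c.Contains R')) = none := by simp [h]
    rw [this]
    unfold HConeN.blowup
    rw [if_neg h]

/-- A legal face is a legal one-member print-move family. [cite: Blanco2012a, Thm. 4.6 B)] -/
theorem legalFamilyN_singleton {A : Finset (Fin n → ℚ)} {S : HStageN n} {R : Finset (Fin n → ℤ)} (h : LegalFaceN A S R) :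
    LegalFamilyN A S [R] :=
  ⟨List.cons_ne_nil _ _, fun R' hR' => by rw [List.mem_singleton.mp hR']; exact h, List.pairwise_singleton _ _⟩

/-- An abstractly done name set of a corner is a strictly won corner. [cite: Blanco2012a, Def. 1.24] -/
theorem strictWonN_of_sum_lt (henc : Function.Injective enc) {A : Finset (Fin n → ℚ)} {c : HConeN n} (hc : c.Indep)
    (v : ↥A) (hlt : ∑ x ∈ names enc c, E enc A x v < 1) : StrictWonN (c.board A) := by
  refine ⟨coordN v.1 c.ray c.height, Finset.mem_image.mpr ⟨v.1, v.2, rfl⟩, ?_⟩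
  rw [sum_names henc hc] at hlt
  have : ∑ k, E enc A (enc (lift c k)) v = ∑ k, coordN v.1 c.ray c.height k :=
    Finset.sum_congr rfl (fun k _ => by show E enc A (enc (c.ray k, c.height k)) v = _; rw [E_enc henc]; rfl)
  rw [this] at hlt
  exact hlt

end Legal

/-! ## §4 The simulation invariant and one step -/

section Simulation

variable {enc : (Fin n → ℤ) × ℤ → ℕ} {A : Finset (Fin n → ℚ)}

/-- THE SIMULATION INVARIANT between a fan stage and an abstract state: independent corners pairwise in face position,
abstract cones = name sets, abstract exponents = `E`, every current name used, and every used name is the code of a current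
ray vector with a height not above its current height (so that bumped heights give fresh names).
[cite: Blanco2012a, Def. 1.16, Def. 1.22] -/
structure Sim (enc : (Fin n → ℤ) × ℤ → ℕ) (A : Finset (Fin n → ℚ)) (S : HStageN n) (s : MGame ↥A) : Prop where
  indep : ∀ c ∈ S, c.Indep
  face : ∀ c ∈ S, ∀ c' ∈ S, c.FaceInter c'
  cones_eq : s.cones = absCones enc S
  expo_eq : s.expo = E enc A
  names_used : ∀ c ∈ S, ∀ k, enc (lift c k) ∈ s.used
  height : ∃ H : (Fin n → ℤ) → ℤ, S.HeightFn H ∧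
    ∀ x ∈ s.used, ∃ c ∈ S, ∃ k : Fin n, ∃ b' : ℤ, b' ≤ c.height k ∧ x = enc (c.ray k, b')

/-- The simulated stage is a fan. [cite: Fulton1993Toric, §2.6] -/
theorem Sim.isFan {S : HStageN n} {s : MGame ↥A} (h : Sim enc A S s) : S.IsFan := by
  obtain ⟨H, hH, -⟩ := h.height
  exact ⟨h.indep, h.face, H, hH⟩

/-- **ONE STEP OF THE SIMULATION.**  An abstract legal face of the current abstract state names a face `R` of the stage;
blowing `R` up upstairs and moving abstractly at `Rabs` with the (fresh) name of the new lifted ray `(ρ_R, 1 + Σ_R H)` keeps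
the simulation invariant.  [cite: Blanco2012a, Def. 1.22; Fulton1993Toric, §2.6] -/
theorem Sim.step (henc : Function.Injective enc) {S : HStageN n} {s : MGame ↥A} (h : Sim enc A S s) {c : HConeN n}
    (hc : c ∈ S) {Rabs : Finset ℕ} (hne : Rabs.Nonempty) (hsub : Rabs ⊆ names enc c) :
    ∃ ρ, s.Fresh ρ ∧ Sim enc A (S.blowup (vecFace enc c Rabs)) (s.move Rabs ρ) := by
  obtain ⟨H, hH, hused⟩ := h.height
  have hcI : c.Indep := h.indep c hc
  set R := vecFace enc c Rabs with hRdef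
  have hRc : c.Contains R := contains_vecFace c Rabs
  have hRne : R.Nonempty := vecFace_nonempty hne hsub
  have hRabs : Rabs = R.image (fun r => enc (r, H r)) := eq_image_vecFace hsub (hH c hc)
  set hnew : ℤ := 1 + ∑ r ∈ R, H r with hnew_def
  set ρ : ℕ := enc (rhoN R, hnew) with hρdef
  -- the slots of R in c are non-empty
  obtain ⟨j₀, hj₀⟩ : (c.slots R).Nonempty := by
    rw [← Finset.card_pos, HConeN.card_slots hcI hRc]; exact hRne.card_pos
  -- FRESHNESS of ρ
  have hfresh : s.Fresh ρ := by
    intro hmem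
    obtain ⟨c', hc', k, b', hb', hx⟩ := hused ρ hmem
    have hpair : (rhoN R, hnew) = (c'.ray k, b') := henc hx
    have hvec : rhoN R = c'.ray k := congrArg Prod.fst hpair
    have hht : hnew = b' := congrArg Prod.snd hpair
    by_cases h2 : 2 ≤ R.card
    · exact rhoN_not_mem_range hcI (h.indep c' hc') (h.face c hc c' hc') hRc h2 ⟨k, hvec.symm⟩
    · have h1 : R.card = 1 := by have := hRne.card_pos; omega
      obtain ⟨r, hr⟩ := Finset.card_eq_one.mp h1
      have hrho : rhoN R = r := by rw [hr]; simp [rhoN]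
      have hHr : H r = c'.height k := by rw [hH c' hc' k, ← hvec, hrho]
      have : hnew = 1 + H r := by rw [hnew_def, hr, Finset.sum_singleton]
      have hb'' : b' ≤ H r := hHr ▸ hb'
      omega
  refine ⟨ρ, hfresh, ?_⟩
  -- the new height function
  obtain ⟨H', hH', hH'old, hH'new⟩ :=
    HStageN.exists_heightFn_blowup h.indep h.face hH hRne ⟨c, hc, hRc⟩
  -- containment of R by a corner of S, in terms of names
  have hcontains : ∀ c' ∈ S, c'.Contains R ↔ Rabs ⊆ names enc c' :=
    fun c' hc' => contains_iff_subset_names henc hsub (hH c hc) (hH c' hc')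
  -- a slot of R in a corner c' ⊇ R has its name in Rabs
  have hslot_mem : ∀ c' ∈ S, c'.Contains R → ∀ j ∈ c'.slots R, enc (lift c' j) ∈ Rabs := by
    intro c' hc' _ j hj
    rw [hRabs]
    have hrj : c'.ray j ∈ R := (HConeN.mem_slots c' R j).mp hj
    refine Finset.mem_image.mpr ⟨c'.ray j, hrj, ?_⟩
    show enc (c'.ray j, H (c'.ray j)) = enc (c'.ray j, c'.height j)
    rw [hH c' hc' j]
  refine ⟨fun d hd => HStageN.indep_of_mem_blowup h.indep hd,
    fun d hd d' hd' => HStageN.faceInter_of_mem_blowup h.indep h.face hd hd', ?_, ?_, ?_, ⟨H', hH', ?_⟩⟩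
  · -- cones
    ext C
    rw [MGame.mem_move_cones, h.cones_eq]
    simp only [mem_absCones]
    constructor
    · rintro (⟨⟨c', hc', rfl⟩, hnsub⟩ | ⟨P, ⟨c', hc', rfl⟩, hsubP, x, hx, rfl⟩)
      · refine ⟨c', HStageN.mem_blowup.mpr ⟨c', hc', Or.inr ⟨fun hh => hnsub ((hcontains c' hc').mp hh), rfl⟩⟩, rfl⟩
      · have hcont' : c'.Contains R := (hcontains c' hc').mpr hsubP
        -- x is the name of a slot j of R in c'
        have hx' : x ∈ (c'.slots R).image (fun k => enc (lift c' k)) := by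
          rw [hRabs] at hx
          obtain ⟨r, hr, rfl⟩ := Finset.mem_image.mp hx
          obtain ⟨j, -, hj⟩ := Finset.mem_image.mp (hcont' hr)
          refine Finset.mem_image.mpr ⟨j, (HConeN.mem_slots c' R j).mpr (hj ▸ hr), ?_⟩
          show enc (c'.ray j, c'.height j) = enc (r, H r)
          rw [hH c' hc' j, hj]
        obtain ⟨j, hj, rfl⟩ := Finset.mem_image.mp hx'
        refine ⟨c'.child (c'.slots R) j, HStageN.mem_blowup.mpr ⟨c', hc', Or.inl ⟨hcont', j, hj, rfl⟩⟩, ?_⟩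
        rw [names_child henc (h.indep c' hc') hcont' (hH c' hc') hj]
    · rintro ⟨d, hd, rfl⟩
      obtain ⟨c', hc', hcase⟩ := HStageN.mem_blowup.mp hd
      rcases hcase with ⟨hcont', j, hj, rfl⟩ | ⟨hncont, rfl⟩
      · right
        refine ⟨names enc c', ⟨c', hc', rfl⟩, (hcontains c' hc').mp hcont', enc (lift c' j),
          hslot_mem c' hc' hcont' j hj, ?_⟩
        rw [names_child henc (h.indep c' hc') hcont' (hH c' hc') hj]
      · exact Or.inl ⟨⟨c', hc', rfl⟩, fun hh => hncont ((hcontains c' hc').mpr hh)⟩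
  · -- exponents
    funext x v
    by_cases hx : x = ρ
    · subst hx
      rw [MGame.expo_move_self, MGame.fsum, h.expo_eq, hRabs,
        Finset.sum_image (fun r _ r' _ hrr' => congrArg Prod.fst (henc hrr'))]
      show ∑ r ∈ R, E enc A (enc (r, H r)) v - 1 = E enc A (enc (rhoN R, hnew)) v
      rw [E_enc henc]
      simp only [E_enc henc, hnew_def, rhoN, Finset.sum_apply, Int.cast_sum, Int.cast_add, Int.cast_one,
        Finset.mul_sum, Finset.sum_sub_distrib]
      rw [Finset.sum_comm]
      ring
    · rw [MGame.expo_move_of_ne _ _ hx, h.expo_eq]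
  · -- names of the new stage are used
    intro d hd k
    rw [MGame.used_move]
    obtain ⟨c', hc', hcase⟩ := HStageN.mem_blowup.mp hd
    rcases hcase with ⟨hcont', j, hj, rfl⟩ | ⟨-, rfl⟩
    · by_cases hkj : k = j
      · subst hkj
        refine Finset.mem_insert.mpr (Or.inl ?_)
        show enc ((c'.child (c'.slots R) k).ray k, (c'.child (c'.slots R) k).height k) = enc (rhoN R, hnew)
        rw [HConeN.ray_child_slots_self (h.indep c' hc') hcont',
          HConeN.height_child_slots_self (h.indep c' hc') hcont' k (hH c' hc')]
      · refine Finset.mem_insert_of_mem ?_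
        have : lift (c'.child (c'.slots R) j) k = lift c' k := by
          show ((c'.child (c'.slots R) j).ray k, (c'.child (c'.slots R) j).height k) = (c'.ray k, c'.height k)
          rw [HConeN.ray_child_of_ne c' _ hkj, HConeN.height_child_of_ne c' _ hkj]
        rw [this]; exact h.names_used c' hc' k
    · exact Finset.mem_insert_of_mem (h.names_used c' hc' k)
  · -- every used name is (current ray, height ≤ current)
    intro x hx
    rw [MGame.used_move, Finset.mem_insert] at hx
    rcases hx with rfl | hx
    · -- the new name: the child of c at j₀ carries the new lifted ray
      refine ⟨c.child (c.slots R) j₀, HStageN.mem_blowup.mpr ⟨c, hc, Or.inl ⟨hRc, j₀, hj₀, rfl⟩⟩, j₀, hnew, ?_, ?_⟩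
      · rw [HConeN.height_child_slots_self hcI hRc j₀ (hH c hc)]
      · rw [HConeN.ray_child_slots_self hcI hRc]
    · obtain ⟨c', hc', k, b', hb', rfl⟩ := hused x hx
      by_cases hcont' : c'.Contains R
      · by_cases hother : ∃ j ∈ c'.slots R, j ≠ k
        · obtain ⟨j, hj, hjk⟩ := hother
          refine ⟨c'.child (c'.slots R) j, HStageN.mem_blowup.mpr ⟨c', hc', Or.inl ⟨hcont', j, hj, rfl⟩⟩, k, b', ?_, ?_⟩
          · rw [HConeN.height_child_of_ne c' _ (Ne.symm hjk)]; exact hb'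
          · rw [HConeN.ray_child_of_ne c' _ (Ne.symm hjk)]
        · -- the face is the single ray of slot k: the child at k keeps the vector and bumps the height
          push Not at hother
          obtain ⟨j₁, hj₁⟩ : (c'.slots R).Nonempty := by
            rw [← Finset.card_pos, HConeN.card_slots (h.indep c' hc') hcont']; exact hRne.card_pos
          have hk : k ∈ c'.slots R := by rw [← hother j₁ hj₁]; exact hj₁
          have hslots : c'.slots R = {k} := by
            ext j; simp only [Finset.mem_singleton]
            exact ⟨fun hj => hother j hj, fun hj => hj ▸ hk⟩
          refine ⟨c'.child (c'.slots R) k, HStageN.mem_blowup.mpr ⟨c', hc', Or.inl ⟨hcont', k, hk, rfl⟩⟩, k, b', ?_, ?_⟩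
          · rw [HConeN.height_child_self, hslots, Finset.sum_singleton]; omega
          · rw [HConeN.ray_child_self, hslots, Finset.sum_singleton]
      · exact ⟨c', HStageN.mem_blowup.mpr ⟨c', hc', Or.inr ⟨hcont', rfl⟩⟩, k, b', hb', rfl⟩

end Simulation

/-! ## §5 Transport of an abstract resolution; the theorem -/

section Transport

variable {enc : (Fin n → ℤ) × ℤ → ℕ} {A : Finset (Fin n → ℚ)}

/-- **TRANSPORT.**  An abstract resolution (a `Solvable` derivation of a simulated state) yields an E-resolution of the stage
by print-moves (one legal face at a time).  [cite: Blanco2012a, Thm. 4.6 C), Def. 1.24] -/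
theorem eResolvable_of_solvable (henc : Function.Injective enc) :
    ∀ s : MGame ↥A, s.Solvable → ∀ S : HStageN n, Sim enc A S s → EResolvable A S := by
  intro s hs
  induction hs with
  | done hall =>
    intro S h
    refine ⟨0, fun c hc => ?_⟩
    have hC : names enc c ∈ _ := h.cones_eq ▸ (mem_absCones.mpr ⟨c, hc, rfl⟩ : names enc c ∈ absCones enc S)
    obtain ⟨v, hv⟩ := hall _ hC
    rw [MGame.fsum, h.expo_eq] at hv
    exact strictWonN_of_sum_lt henc (h.indep c hc) v hv
  | step Rabs hlegal _ ih =>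
    intro S h
    rename_i s _
    obtain ⟨hne, ⟨P, hP, hsubP⟩, hsum⟩ := hlegal
    rw [h.cones_eq] at hP
    obtain ⟨c, hc, rfl⟩ := mem_absCones.mp hP
    have hsum' : ∀ v : ↥A, (1 : ℚ) ≤ ∑ x ∈ Rabs, E enc A x v := by
      intro v; have := hsum v; rwa [MGame.fsum, h.expo_eq] at this
    have hlegalN : LegalFaceN A S (vecFace enc c Rabs) := legalFaceN_of_sums henc h.isFan hc hne hsubP hsum'
    obtain ⟨ρ, hρ, hsim⟩ := h.step henc hc hne hsubP
    obtain ⟨k, hk⟩ := ih ρ hρ _ hsim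
    refine ⟨k + 1, Or.inr ⟨[vecFace enc c Rabs], legalFamilyN_singleton hlegalN, ?_⟩⟩
    rw [blowupFamily_singleton]
    exact hk

/-- **E-RESOLUTION OF EVERY STRICTLY REACHABLE STAGE.**  For a position `A`, every stage reached from the standard corner
by legal single-face blow-ups admits an E-resolution by print-moves: the stage is a fan with coherent heights, its abstract
state is well-formed (boards are positions), `MGame.solvable_of_wf` resolves it abstractly, and the resolution transports.
[cite: Blanco2012a, Thm. 4.6 C) (monomial case)] -/
theorem eResolvable_of_strictReachableN {A : Finset (Fin n → ℚ)} (hA : IsPosition A) {S : HStageN n}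
    (hS : StrictReachableN A S) : EResolvable A S := by
  obtain ⟨enc, henc⟩ := Countable.exists_injective_nat ((Fin n → ℤ) × ℤ)
  have hfan := hS.isFan
  obtain ⟨hI, hF, H, hH⟩ := hfan
  have hpos := hS.isPosition_board hA
  haveI : Nonempty ↥A := hA.1.coe_sort
  -- the initial abstract state: name sets, exponent table E, used = all current names
  let s₀ : MGame ↥A := absState enc A S ((absCones enc S).biUnion id)
  have hWF : s₀.WF n := by
    refine ⟨fun C hC => ?_, fun C hC => ?_, fun C hC x hx v => ?_⟩
    · obtain ⟨c, hc, rfl⟩ := mem_absCones.mp hC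
      exact card_names henc (hI c hc)
    · exact Finset.subset_biUnion_of_mem id hC
    · obtain ⟨c, hc, rfl⟩ := mem_absCones.mp hC
      obtain ⟨k, rfl⟩ := (mem_names (enc := enc)).mp hx
      show 0 ≤ E enc A (enc (c.ray k, c.height k)) v
      rw [E_enc henc]
      have := (hpos c hc).2 (coordN v.1 c.ray c.height) (Finset.mem_image.mpr ⟨v.1, v.2, rfl⟩) k
      exact this
  have hSim : Sim enc A S s₀ := by
    refine ⟨hI, hF, rfl, rfl, fun c hc k => ?_, ⟨H, hH, fun x hx => ?_⟩⟩
    · exact Finset.mem_biUnion.mpr ⟨names enc c, mem_absCones.mpr ⟨c, hc, rfl⟩,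
        (mem_names (enc := enc)).mpr ⟨k, rfl⟩⟩
    · obtain ⟨C, hC, hxC⟩ := Finset.mem_biUnion.mp hx
      obtain ⟨c, hc, rfl⟩ := mem_absCones.mp hC
      obtain ⟨k, rfl⟩ := (mem_names (enc := enc)).mp hxC
      exact ⟨c, hc, k, c.height k, le_rfl, rfl⟩
  exact eResolvable_of_solvable henc s₀ (MGame.solvable_of_wf n _ s₀ hWF) S hSim

end Transport

end MonomialTransport

/-- **F-70 DISCHARGED: Blanco 2012 (Part I) Thm. 4.6, monomial case, chart-wise on fan stages.**  For every dimension `n`,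
every position `A` and every strictly reachable stage `S`, the BBOE of the stage admits an E-resolution
(`EResolvable A S`).  Proof: the abstract marked-monomial game is solvable in every dimension (`MGame.solvable_of_wf`,
Encinas–Villamayor's monomial case + junior games at contact rays, one contact ray at a time), and abstract resolutions
transport to fan stages (`MonomialTransport.eResolvable_of_strictReachableN`).
[cite: Blanco2012a, Thm. 4.6 C) with B), Def. 1.16/1.18/1.22/1.24, Rem. 1.23 (arXiv 0902.2887 numbering)] -/
theorem Blanco2012a_thm_4_6_monomial_holds : Blanco2012a_thm_4_6_monomial :=
  fun _n _A _S hA hS => MonomialTransport.eResolvable_of_strictReachableN hA hS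

end Literature.Combinatorics.HironakaPolyhedraGame
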